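import Literature.AnabelianGeometry.SemiGraphs.TemperedCurveGaloisCyclotome
import Literature.AnabelianGeometry.AbsoluteAnabelian.GaloisCyclotomeOpenSubgroupNaturality
import HarnessLib

/-!
# `μ_Ẑ(G_K) ⥲ Λ(ℚ̄_pˣ)` at a tempered curve's base Galois group is NATURAL for the OUTER automorphisms `conj_τ|_{G_K}`,
# `τ ∈ N_{G_{ℚ_p}}(G_K)` (proof-only sequel of `TemperedCurveGaloisCyclotome`)

Mochizuki, *Topics in Absolute Anabelian Geometry III*, §1, Cor. 1.10 (i)(a)/(c) p. 42 ("functorial group-theoretic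
algorithm"; "the natural isomorphism `μ_Ẑ(G_k) ⥲ μ_Ẑ(Π_X)`") [cite: MochizukiAbsTopIII2015, Cor 1.10 (i) p.42]; *The absolute
anabelian geometry of hyperbolic curves* (2004), Prop. 1.2.1 (vi) p. 10; *Semi-graphs of anabelioids* (2006) §6 p. 69
(`G_K := Gal(K̄/K)`) [cite: MochizukiSemiAnbd2006, §6 p.69].

abc-iut cell; seat abc-iut-w5-d145 (gen 4), support chain «CW5D145-CONSOLIDATE» piece P2a for GAP-LEDGER G-w5d145-2 (the
Galois half of the residual (C′) of [IUTchII] Cor. 1.11 (b)). abc-iut-w5-d145 gen 3 proved (`TemperedCurveGaloisCyclotome`,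
p430343) that for every tempered curve `X` the group-theoretic cyclotome `μ_Ẑ(G_K)`, `G_K = K.fixingSubgroup ≤ G_{ℚ_p}`, is
`Λ(ℚ̄_pˣ) = Ẑ(1)` `G_K`-EQUIVARIANTLY (inner automorphisms of `G_K` act by the cyclotomic character). THIS FILE adds the
naturality any consumer of [AbsTopIII] Cor. 1.10 (c) for OUTER automorphisms needs on the Galois side:

* `TemperedCurve.exists_muZhat_GK_mulEquiv_cyclotome_natural` — there is `f : μ_Ẑ(G_K) ⥲ Λ(ℚ̄_pˣ)`, `G_K`-equivariant, such that
  for every `τ ∈ G_{ℚ_p}` and every topological automorphism `ψ` of `G_K` which IS `conj_τ` on underlying elements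
  (`(ψ σ : G_{ℚ_p}) = τ σ τ⁻¹` — so `τ` normalises `G_K`; `ψ` is in general an OUTER automorphism of `G_K`),
  `f (μ_Ẑ(ψ) ζ)_n = τ (f ζ)_n`: transporting the group-theoretic cyclotome along `ψ` is the field action of `τ` on roots of
  unity. Proof: `f` is L4's LCFT identification at `ℚ_p` (`exists_muZhat_mulEquiv_cyclotome_units ℚ_[p]`, `G_{ℚ_p}`-equivariant)
  composed with the open-subgroup invariance `μ_Ẑ(G_K) ⥲ μ_Ẑ(G_{ℚ_p})`, which is natural in the compatible pair
  `(conj_τ, ψ)` (`muZhat.restrictOpenEquiv_congr_of_compat`, P1), and `μ_Ẑ(conj_τ) = τ •` on `μ_Ẑ(G_{ℚ_p})` (`muZhat.congr_conj`).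

Proof-only (no definitions); classical; nothing here bears on [IUTchIII] Cor. 3.12.
-/

noncomputable section

namespace Literature.AnabelianGeometry.AbsoluteAnabelian

universe u

variable {G : Type u} [Group G] [TopologicalSpace G] [IsTopologicalGroup G] [CompactSpace G]

/-- **`μ_Ẑ(conj_g) = g • (·)`** on abc-iut-L4-t1's cyclotome: transporting `μ_Ẑ(G)` along the inner automorphism `conj_g` IS
the `G`-module action of `g` (the cyclotomic character of `G` restricted from `Aut(G)` to `Inn(G)`; definitional —
[AbsAnab] Prop. 1.2.1 (vi)). [cite: MochizukiAbsTopIII2015, Cor 1.10 (i) p.42] -/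
theorem muZhat.congr_conj (g : G) (ζ : muZhat G) : muZhat.congr (conjContinuousMulEquiv g) ζ = g • ζ :=
  Subtype.ext (funext fun _ => rfl)

end Literature.AnabelianGeometry.AbsoluteAnabelian

namespace Literature.AnabelianGeometry.SemiGraphs.TemperedCurve

open Literature.AnabelianGeometry.AbsoluteAnabelian

variable {p : ℕ} [Fact p.Prime] (X : TemperedCurve p)

/-- **`μ_Ẑ(G_K) ≅ Λ(ℚ̄_pˣ)`, `G_K`-equivariantly AND naturally for the outer automorphisms `conj_τ|_{G_K}`** ([AbsTopIII] Cor. 1.10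
(i)(a) functoriality + [AbsAnab] Prop. 1.2.1 (vi), at the genuine base Galois group of a tempered curve): there is an isomorphism
`f` of the group-theoretic cyclotome `μ_Ẑ(G_K)` onto the compatible systems of roots of unity of `ℚ̄_p` such that
(1) `f (g • ζ)_n = g (f ζ)_n` for `g ∈ G_K` (the conjugation action IS the cyclotomic character), and
(2) for every `τ ∈ G_{ℚ_p} = Gal(ℚ̄_p/ℚ_p)` and every topological automorphism `ψ` of `G_K` with `(ψ σ : G_{ℚ_p}) = τ σ τ⁻¹`,
`f (μ_Ẑ(ψ) ζ)_n = τ (f ζ)_n`. [cite: MochizukiAbsTopIII2015, Cor 1.10 (i) p.42] -/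
theorem exists_muZhat_GK_mulEquiv_cyclotome_natural [CompactSpace X.GK] :
    ∃ f : muZhat X.GK ≃* EtaleTheta.cyclotome (AlgebraicClosure ℚ_[p])ˣ,
      (∀ (g : X.GK) (ζ : muZhat X.GK) (n : ℕ+),
        ((((f (g • ζ) : EtaleTheta.cyclotome (AlgebraicClosure ℚ_[p])ˣ) : ℕ+ → (AlgebraicClosure ℚ_[p])ˣ) n :
            (AlgebraicClosure ℚ_[p])ˣ) : AlgebraicClosure ℚ_[p]) =
          (g : GQp p) ((((f ζ : EtaleTheta.cyclotome (AlgebraicClosure ℚ_[p])ˣ) : ℕ+ → (AlgebraicClosure ℚ_[p])ˣ) n :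
            (AlgebraicClosure ℚ_[p])ˣ) : AlgebraicClosure ℚ_[p])) ∧
      ∀ (τ : GQp p) (ψ : X.GK ≃ₜ* X.GK) (_hψ : ∀ σ : X.GK, ((ψ σ : X.GK) : GQp p) = τ * σ * τ⁻¹)
        (ζ : muZhat X.GK) (n : ℕ+),
        ((((f (muZhat.congr ψ ζ) : EtaleTheta.cyclotome (AlgebraicClosure ℚ_[p])ˣ) : ℕ+ → (AlgebraicClosure ℚ_[p])ˣ) n :
            (AlgebraicClosure ℚ_[p])ˣ) : AlgebraicClosure ℚ_[p]) =
          τ ((((f ζ : EtaleTheta.cyclotome (AlgebraicClosure ℚ_[p])ˣ) : ℕ+ → (AlgebraicClosure ℚ_[p])ˣ) n :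
            (AlgebraicClosure ℚ_[p])ˣ) : AlgebraicClosure ℚ_[p]) := by
  haveI : CompactSpace (GQp p) := inferInstanceAs (CompactSpace (Field.absoluteGaloisGroup ℚ_[p]))
  haveI : IsNonarchimedeanLocalField ℚ_[p] :=
    Literature.NumberTheory.GaloisRepresentations.Padic.isNonarchimedeanLocalField_holds p
  let H : OpenSubgroup (GQp p) := ⟨X.GK, X.isOpen_GK⟩
  obtain ⟨e, he⟩ := exists_muZhat_mulEquiv_cyclotome_units ℚ_[p]
  refine ⟨(muZhat.restrictOpenEquiv H).trans e, fun g ζ n => ?_, fun τ ψ hψ ζ n => ?_⟩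
  · rw [MulEquiv.trans_apply, MulEquiv.trans_apply, muZhat.restrictOpenEquiv_smul H g ζ]
    exact he (g : GQp p) _ n
  · rw [MulEquiv.trans_apply, MulEquiv.trans_apply,
      muZhat.restrictOpenEquiv_congr_of_compat H H (conjContinuousMulEquiv τ) ψ
        (fun σ => by rw [conjContinuousMulEquiv_apply]; exact hψ σ) ζ,
      muZhat.congr_conj]
    exact he τ _ n

end Literature.AnabelianGeometry.SemiGraphs.TemperedCurve

end
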